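import Literature.AnabelianGeometry.SemiGraphs.PSCUnrVerticialOneVertex
import Mathlib.Topology.Instances.ZMod
import HarnessLib

/-!
# [IUTchI] Rmk. 1.2.3 (iv), verticial half AS TYPED (`UnrVerticialCharacterizationHolds`, FACT-LIST row F-1938):
# a BINDER-FREE instance form at the COMMUTATIVE smooth-proper shape origin — a labelled TOY (proof-only)

S. Mochizuki, *Inter-universal Teichmüller theory I*, kurims manuscript (May 2020), §1, Remark 1.2.3 (iv) p. 42
(replacement text of [CombGC] Rmk. 1.4.3, verticial half): "the inclusions `M^unr_G[v] ⊆ M^unr_G` determine a split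
injection `⊕_v M^unr_G[v] ↪ M^unr_G` … [an elementary abelian quotient] corresponds to a verticially purely totally
ramified covering if and only if …" [cite: Mochizuki2012, IUTchI Rmk 1.2.3(iv) p.42] (D-0012 claim key; series status
DISPUTED; the content used here is elementary topological group theory over abc-iut-L3-t4's interface `PSCDatum`;
no side taken).  abc-iut cell, block F, KEY INST59L1 (seat abc-iut-f-186 gen 3), FACT-LIST row **F-1938**.
PROOF-ONLY companion of `PSCRamification.lean` (no `def`, no `instance`, nothing re-typed).

STATUS OF THE ROW (plan/LF-KERNEL-STATUS.tsv 2026-08-27T12:11Z; abc-iut finding F-L3t4g5-1,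
`PSCUnrVerticialOneVertex.lean`): the typed predicate `UnrVerticialCharacterizationHolds Ω` = "for every `G` of
`Ω`-PSC-type, `UnrVerticialSplitInjection ∧ ElementaryQuotientVerticiallyRamifiedIff`" is REFUTED at every origin
containing a ONE-VERTEX STURDY datum over a NONABELIAN T₁ group — in particular at the genuine data of smooth
hyperbolic curves (`not_unrVerticialCharacterizationHolds_of_genus2OnePoint`) and at the smooth-proper SHAPE origin
(`exists_smoothProperOrigin_holds`, last conjunct) — because at one vertex the typed independence clause forces
`[Π, Π] ≤ closure {1}`; its universal closure is false (`not_forall_unrVerticialCharacterizationHolds`); the corrected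
successor `UnrVerticialCharacterizationHolds'` is a different decl.  No theorem in the tree has the ROW ITSELF as head.

WHAT THIS FILE RECORDS — the other side of exactly that dividing line:

* `unrVerticialCharacterizationHolds_commSmoothProperOrigin` — **INSTANCE FORM, 0 binders, 0 hypotheses**: the row
  HOLDS at the origin `Ω_sp^comm` := "one vertex, no node, no cusp, `Π_v = Π`, and `Π` COMMUTATIVE" (written inline as
  an anonymous `PSCOrigin`).  Mechanism: with no edge and `Π` commutative, `E^unr_G = closure {1}`, `M^unr_G[v] = Π`,
  so the independence clause and the closed complement (`C := E^unr_G`) hold, and every open normal `H' ⊇ E^unr_G` of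
  exponent `l` IS verticially purely totally ramified at the unique vertex (the double coset of `1` over `Π`, `Π_v = Π`
  is everything), matching the right-hand side of the elementary-quotient criterion;
* `exists_sturdy_mem_commSmoothProperOrigin` — NON-VACUITY in every hypothesis of the row: `Ω_sp^comm` declares of
  PSC-type a STURDY datum (genus `2` at its vertex) with `Σ = {2}` over the discrete group `ℤ/2` — so `IsSturdy`,
  `Σ = {l}` (`l = 2`), and the quantified `H'` (`H' = 1` and `H' = Π` both qualify) are all instantiated;
* `unrVerticialCharacterizationHolds_decided_by_commutativity` — inside the smooth-proper shape the row is DECIDED BY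
  COMMUTATIVITY: it holds at `Ω_sp^comm` and fails at the full shape origin `Ω_sp` (nonabelian dihedral witness of
  abc-iut-L3-t4's lineage, BY NAME).

HONEST LABEL «TOY CARRIER»: a commutative `Π` is NEVER the PSC-fundamental group of a pointed stable curve (those are
centre-free, [CombGC] Rmk. 1.1.3); the instance is consistency evidence about OUR typed predicate — it isolates
commutativity of `Π` as the exact reason the typed row fails at genuine one-vertex data — and says nothing about the
printed remark, whose genuine instance form is the corrected `UnrVerticialCharacterizationHolds'` at multi-component
data (open; abc-iut-L3 lineage).  typed ≠ proved; refuted-as-typed ≠ refuted-in-print; nothing here bears on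
[IUTchIII] Cor. 3.12 or asserts anything about abc.
-/

noncomputable section

namespace Literature.AnabelianGeometry.SemiGraphs

namespace PSCDatum

open scoped Pointwise

universe u

variable {P : Type u} [Group P] [TopologicalSpace P] [IsTopologicalGroup P]

/-! ### The two typed clauses at a one-vertex, edge-free datum over a commutative group -/

/-- With no node, no cusp and `Π` commutative, `E^unr_G ≤ closure {1}` (hence `=`): the commutator subgroup is
trivial and the edge-like subgroups generate nothing. [cite: Mochizuki2012, IUTchI Rmk 1.2.3(iv) p.42] -/
private theorem unrAbKer_le_closure_bot (G : PSCDatum P) [IsEmpty G.graph.N] [IsEmpty G.graph.C]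
    (hcomm : ∀ a b : P, a * b = b * a) : G.unrAbKer ≤ (⊥ : Subgroup P).topologicalClosure := by
  haveI : ((⊥ : Subgroup P).topologicalClosure).Normal := Subgroup.is_normal_topologicalClosure ⊥
  refine Subgroup.topologicalClosure_minimal _ (sup_le ?_ ?_) (Subgroup.isClosed_topologicalClosure ⊥)
  · -- `[Π, Π] = 1`
    rw [Subgroup.commutator_eq_bot_iff_le_centralizer.mpr fun x _ =>
      Subgroup.mem_centralizer_iff.mpr fun y _ => hcomm y x]
    exact bot_le
  · -- no edge-like subgroups
    refine Subgroup.topologicalClosure_minimal _ (Subgroup.normalClosure_le_normal ?_)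
      (Subgroup.isClosed_topologicalClosure ⊥)
    intro x hx
    simp only [Set.mem_union, Set.mem_iUnion] at hx
    rcases hx with ⟨c, -⟩ | ⟨e, -⟩
    · exact isEmptyElim c
    · exact isEmptyElim e

/-- **The typed split injection HOLDS at a one-vertex, edge-free datum with `Π_v = Π` over a commutative `Π`.**
[cite: Mochizuki2012, IUTchI Rmk 1.2.3(iv) p.42] -/
private theorem unrVerticialSplitInjection_of_comm (G : PSCDatum P) [IsEmpty G.graph.N] [IsEmpty G.graph.C]
    (hV : ∀ v, G.vertGp v = ⊤) (v₀ : G.graph.V) (hv : ∀ w, w = v₀) (hcomm : ∀ a b : P, a * b = b * a) :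
    G.UnrVerticialSplitInjection := by
  intro _
  have hle := G.unrAbKer_le_closure_bot hcomm
  have hge : (⊥ : Subgroup P).topologicalClosure ≤ G.unrAbKer := Subgroup.topologicalClosure_mono bot_le
  have hKer : G.unrAbKer = (⊥ : Subgroup P).topologicalClosure := le_antisymm hle hge
  -- `M^unr_G[v] = Π`
  have hvert : ∀ v, G.unrVertAbOf v = ⊤ := fun v =>
    top_le_iff.mp ((hV v).symm.le.trans (le_sup_left.trans (Subgroup.le_topologicalClosure _)))
  have hsup : (⨆ v : G.graph.V, G.unrVertAbOf v).topologicalClosure = ⊤ :=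
    top_le_iff.mp (((hvert v₀).symm.le.trans (le_iSup (fun v => G.unrVertAbOf v) v₀)).trans
      (Subgroup.le_topologicalClosure _))
  refine ⟨fun v => ?_, G.unrAbKer, Subgroup.isClosed_topologicalClosure _, le_rfl, ?_, ?_⟩
  · -- the "other vertices" form an empty family
    haveI : IsEmpty {w : G.graph.V // w ≠ v} := ⟨fun w => w.2 ((hv w.1).trans (hv v).symm)⟩
    rw [iSup_of_empty, hvert, top_inf_eq, hKer]
  · rw [hsup, inf_top_eq]
  · rw [hsup, sup_top_eq]

/-- **The typed elementary-quotient criterion HOLDS at a one-vertex datum with `Π_v = Π`** (any `Π`): both sides of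
the "iff" are true for every admissible `H'`. [cite: Mochizuki2012, IUTchI Rmk 1.2.3(iv) p.42] -/
private theorem elementaryQuotientVerticiallyRamifiedIff_of_vertGp_eq_top (G : PSCDatum P)
    (hV : ∀ v, G.vertGp v = ⊤) (v₀ : G.graph.V) (hv : ∀ w, w = v₀) :
    G.ElementaryQuotientVerticiallyRamifiedIff := by
  intro _ l H' _ hN hO _ _
  refine ⟨fun _ => ⟨v₀, by rw [hV v₀, top_sup_eq], fun v' hv' => absurd (hv v') hv'⟩, fun _ => ?_⟩
  haveI := hN
  refine ⟨⟨le_top, hO, by simp, inferInstance⟩, v₀, 1, by rw [one_smul, hV v₀, top_inf_eq, top_sup_eq], ?_⟩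
  rintro v' γ' (hne | hnot)
  · exact absurd (hv v') hne
  · refine absurd ?_ hnot
    rw [hV v₀]
    exact DoubleCoset.mem_doubleCoset.mpr
      ⟨ConjAct.ofConjAct γ', Subgroup.mem_top _, 1, Subgroup.mem_top _, by simp⟩

/-! ### The instance form at the commutative smooth-proper shape origin -/

/-- **[IUTchI] Rmk. 1.2.3 (iv), verticial half AS TYPED, HOLDS at the commutative smooth-proper shape origin —
instance form of F-1938, no binders, no hypotheses.**  At the origin declaring "of PSC-type" exactly the data with one
vertex, no node, no cusp, `Π_v = Π` and `Π` COMMUTATIVE, `UnrVerticialCharacterizationHolds` holds.  HONEST LABEL: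
TOY carrier (a commutative `Π` is never a PSC-fundamental group); at the genuine one-vertex data (nonabelian `Π`) the
row FAILS (`not_unrVerticialCharacterizationHolds_of_genus2OnePoint`). [cite: Mochizuki2012, IUTchI Rmk 1.2.3(iv) p.42] -/
theorem unrVerticialCharacterizationHolds_commSmoothProperOrigin :
    Literature.AnabelianGeometry.SemiGraphs.PSCDatum.UnrVerticialCharacterizationHolds
      (⟨fun {Q} _ _ G => IsEmpty G.graph.N ∧ IsEmpty G.graph.C ∧ (∀ v, G.vertGp v = ⊤) ∧
          (∃ v₀ : G.graph.V, ∀ w, w = v₀) ∧ ∀ a b : Q, a * b = b * a⟩ : PSCOrigin.{0}) := by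
  intro Q _ _ _ G hG
  obtain ⟨hN, hC, hV, ⟨v₀, hv⟩, hcomm⟩ :
      IsEmpty G.graph.N ∧ IsEmpty G.graph.C ∧ (∀ v, G.vertGp v = ⊤) ∧
        (∃ v₀ : G.graph.V, ∀ w, w = v₀) ∧ ∀ a b : Q, a * b = b * a := hG
  exact ⟨G.unrVerticialSplitInjection_of_comm hV v₀ hv hcomm,
    G.elementaryQuotientVerticiallyRamifiedIff_of_vertGp_eq_top hV v₀ hv⟩

/-- **The commutative smooth-proper origin declares a STURDY datum of PSC-type, with `Σ` a singleton**: over the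
discrete group `ℤ/2` (written multiplicatively), `Σ = {2}`, one vertex of genus `2` with `Π_v = Π`, no edge.  So in
`unrVerticialCharacterizationHolds_commSmoothProperOrigin` the hypotheses `IsSturdy` and `Σ = {l}` of the two typed
clauses are instantiated (at `l = 2`, where both `H' = 1` and `H' = Π` are admissible open normal subgroups of
exponent `l` containing `E^unr_G = 1`): the instance is not vacuous.  TOY carrier, labelled as such.
[cite: Mochizuki2012, IUTchI Rmk 1.2.3(iv) p.42] -/
theorem exists_sturdy_mem_commSmoothProperOrigin :
    ∃ G : PSCDatum (Multiplicative (ZMod 2)),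
      (⟨fun {Q} _ _ G => IsEmpty G.graph.N ∧ IsEmpty G.graph.C ∧ (∀ v, G.vertGp v = ⊤) ∧
          (∃ v₀ : G.graph.V, ∀ w, w = v₀) ∧ ∀ a b : Q, a * b = b * a⟩ : PSCOrigin.{0}).IsOfPSCType G ∧
        G.IsSturdy ∧ G.Sigma = {2} ∧ G.graph.i = 1 ∧ G.graph.n = 0 ∧ G.graph.r = 0 ∧
        ∀ v, G.vertGp v = ⊤ ∧ G.genus v = 2 := by
  have hcard : Nat.card (Multiplicative (ZMod 2)) = 2 := by
    rw [Nat.card_congr Multiplicative.toAdd, Nat.card_zmod]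
  let G : PSCDatum (Multiplicative (ZMod 2)) :=
    { Sigma := {2}
      sigma_prime := fun p hp => by rw [Set.mem_singleton_iff.mp hp]; exact Nat.prime_two
      sigma_nonempty := ⟨2, rfl⟩
      graph := { V := Unit, N := Empty, C := Empty, nodeEnds := Empty.elim, cuspEnd := Empty.elim }
      vertGp := fun _ => ⊤
      nodeGp := Empty.elim
      cuspGp := Empty.elim
      genus := fun _ => 2
      isClosed_vertGp := fun _ => isClosed_discrete _
      isClosed_nodeGp := fun e => e.elim
      isClosed_cuspGp := fun c => c.elim
      nodeGp_le := fun e => e.elim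
      cuspGp_le := fun c => c.elim
      proSigma := ⟨fun U _ p hp hdvd => by
        have h2 : Nat.card (Multiplicative (ZMod 2) ⧸ U.toSubgroup) ∣ 2 := by
          have h := Subgroup.card_quotient_dvd_card U.toSubgroup
          rwa [hcard] at h
        exact Set.mem_singleton_iff.mpr
          ((Nat.prime_dvd_prime_iff_eq hp Nat.prime_two).mp (hdvd.trans h2))⟩ }
  exact ⟨G, ⟨inferInstanceAs (IsEmpty Empty), inferInstanceAs (IsEmpty Empty), fun _ => rfl, ⟨(), fun _ => rfl⟩,
      fun a b => mul_comm a b⟩, fun _ => le_rfl, rfl, rfl, rfl, rfl, fun _ => ⟨rfl, rfl⟩⟩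

/-- **Inside the smooth-proper shape, F-1938 is decided by commutativity of `Π`**: the row HOLDS at the (inhabited,
sturdy) commutative smooth-proper origin and FAILS at the full smooth-proper shape origin `Ω_sp` (one vertex, no
edge, `Π_v = Π`, any `Π`; abc-iut-L3-t4 lineage's `exists_smoothProperOrigin_holds`, nonabelian dihedral witness) —
and a fortiori its universal closure fails (`not_forall_unrVerticialCharacterizationHolds`).
[cite: Mochizuki2012, IUTchI Rmk 1.2.3(iv) p.42] -/
theorem unrVerticialCharacterizationHolds_decided_by_commutativity :
    (∃ Ω : PSCOrigin.{0},
        (∃ G : PSCDatum (Multiplicative (ZMod 2)), Ω.IsOfPSCType G ∧ G.IsSturdy ∧ G.Sigma = {2}) ∧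
          UnrVerticialCharacterizationHolds Ω) ∧
      (∃ Ω : PSCOrigin.{0},
        (∃ G : PSCDatum (Literature.IUT.HodgeTheaters.profiniteCompletion
            (Literature.GroupTheory.CombinatorialGroupTheory.PuncturedSurfaceGroup 2 0)),
          Ω.IsOfPSCType G ∧ G.IsSturdy) ∧
          ¬ UnrVerticialCharacterizationHolds Ω) ∧
      ¬ ∀ Ω : PSCOrigin.{0}, UnrVerticialCharacterizationHolds Ω := by
  refine ⟨⟨_, ?_, unrVerticialCharacterizationHolds_commSmoothProperOrigin⟩, ?_,
    not_forall_unrVerticialCharacterizationHolds⟩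
  · obtain ⟨G, hG, hst, hS, -⟩ := exists_sturdy_mem_commSmoothProperOrigin
    exact ⟨G, hG, hst, hS⟩
  · obtain ⟨Ω, ⟨G, hG, hst, -⟩, -, -, -, -, -, -, -, -, -, -, hneg⟩ := exists_smoothProperOrigin_holds
    exact ⟨Ω, ⟨G, hG, hst⟩, hneg⟩

end PSCDatum

end Literature.AnabelianGeometry.SemiGraphs

end
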